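import Mathlib
import Summits.NavierStokesRegularity.NavierStokesRegularity.Theorems.FilamentSkeletonRssKelvinGateHeatWeight
import Summits.NavierStokesRegularity.NavierStokesRegularity.Theorems.FilamentSkeletonRssKelvinGateOUSlice
import Summits.NavierStokesRegularity.NavierStokesRegularity.Theorems.FilamentSkeletonRssKelvinGateTransport

/-!
# Route `FilamentSkeletonRss` · crux `TransverseReductionRJ` (stmt-NavierStokesRegularity-21221) — line `kelvin_gate`,
# stub S2′ `EventualKelvinGate`: bounds, `s`-continuity and kernels for the free semigroup slices

Helper file (theorems only, `--supports stmt-NavierStokesRegularity-21221 --as helper`).  HONEST FRAMING: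
analysis bookkeeping for a HYPOTHETICAL filament-type rotating-self-similar blow-up route; nothing here
bears on Navier–Stokes regularity; no stub is proved here.

With `W_s(y) = (e^{-s/2} R_{−αs}) (e^{(1 − e^{-s})Δ} F)(e^{-s/2} R_{αs} y)` the free semigroup slice of
`…KelvinGateOUSlice` (written out; no definitions), this file provides what the resolvent `W = ∫₀^∞ W_s ds`
(next file) needs, for `F ∈ C¹` bounded with bounded derivative:

* elementary scale inequalities: `s e^{-s} ≤ 1 − e^{-s}`, `(1 − e^{-s})^{-1/2} ≤ s^{-1/2} e^{s/2}`,
  `(1 + e^{-s/2} a)^{-2} ≤ e^{s/2} (1 + a)^{-1}`, and integrability on `(0, ∞)` of `e^{-s/2}`, `s^{-1/2} e^{-s}`,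
  `s^{-1/2} e^{-s/2}`;
* DOMINATION (uniform in `y`): `‖W_s(y)‖ ≤ C₀ e^{-s/2}`, `‖DW_s(y)‖ ≤ C₁ e^{-s}`, `‖D²W_s(y)‖ ≤ 2^{3/2} C₁ s^{-1/2} e^{-s}`;
* WEIGHTED bounds from the quadratic-weight caloric estimates of `…KelvinGateHeatWeight`
  (`(1+|z|)² ‖F z‖ ≤ A`, `(1+|z|)² ‖DF z‖ ≤ A'`): `‖W_s(y)‖ ≤ 2 C_G A · e^{s/2}/(e^{s/2} + |y|)²` (the transport
  kernel of `…KelvinGateTransport`, integral `2/(1+|y|)`), `‖DW_s(y)‖ ≤ 2 C_G A' e^{-s/2}/(1+|y|)`,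
  `‖D²W_s(y)‖ ≤ 5·2^{3/2} C_G A' · s^{-1/2} e^{-s/2}/(1+|y|)`;
* CONTINUITY in `s` on `(0, ∞)` of `W_s(y)`, `DW_s(y)`, `D²W_s(y)` (joint smoothness of the caloric extension,
  `IsSmoothSpaceTimeOn` calculus of `Literature.Analysis.FluidPDE.SpaceTimeCalculus`), hence measurability.
-/

set_option linter.dupNamespace false

noncomputable section

namespace Summit.NavierStokesRegularity.NavierStokesRegularity.Theorems.KelvinGate

open Set Function Filter Topology InnerProductSpace MeasureTheory Real
open Literature.Analysis.FluidPDE Literature.Analysis.UnboundedOperators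
open scoped Laplacian RealInnerProductSpace ContDiff Topology ENNReal

/-! ## Elementary scale inequalities and kernels -/

/-- `s e^{-s} ≤ 1 − e^{-s}` (from `1 + s ≤ e^{s}`). -/
theorem mul_exp_neg_le_heatTime (s : ℝ) : s * exp (-s) ≤ 1 - exp (-s) := by
  have h := add_one_le_exp s
  have he : 0 < exp (-s) := exp_pos _
  have h2 : (s + 1) * exp (-s) ≤ exp s * exp (-s) := mul_le_mul_of_nonneg_right h he.le
  rw [← exp_add, add_neg_cancel, exp_zero] at h2
  linarith

/-- `(1 − e^{-s})^{-1/2} ≤ s^{-1/2} e^{s/2}` for `s > 0`. -/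
theorem heatTime_rpow_neg_half_le {s : ℝ} (hs : 0 < s) :
    (1 - exp (-s)) ^ (-(1 / 2 : ℝ)) ≤ s ^ (-(1 / 2 : ℝ)) * exp (s / 2) := by
  have hτ : 0 < s * exp (-s) := by positivity
  have h1 : (1 - exp (-s)) ^ (-(1 / 2 : ℝ)) ≤ (s * exp (-s)) ^ (-(1 / 2 : ℝ)) :=
    rpow_le_rpow_of_nonpos hτ (mul_exp_neg_le_heatTime s) (by norm_num)
  refine h1.trans (le_of_eq ?_)
  rw [mul_rpow hs.le (exp_pos _).le, ← Real.exp_mul]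
  congr 2
  ring

/-- `(1 + e^{-s/2} a)⁻² ≤ e^{s/2} / (1 + a)` for `s, a ≥ 0` (one power of the weight is kept). -/
theorem inv_weight_sq_le {s a : ℝ} (hs : 0 ≤ s) (ha : 0 ≤ a) :
    ((1 + exp (-(s / 2)) * a) ^ 2)⁻¹ ≤ exp (s / 2) / (1 + a) := by
  have he : 0 < exp (-(s / 2)) := exp_pos _
  have he1 : exp (-(s / 2)) ≤ 1 := exp_le_one_iff.mpr (by linarith)
  have hw : 0 < 1 + exp (-(s / 2)) * a := by positivity
  -- `(1 + e^{-s/2} a) ≥ e^{-s/2} (1 + a)` and `(1 + e^{-s/2} a) ≥ 1`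
  have h1 : exp (-(s / 2)) * (1 + a) ≤ 1 + exp (-(s / 2)) * a := by nlinarith
  have h2 : 1 ≤ 1 + exp (-(s / 2)) * a := by nlinarith
  rw [inv_le_iff_one_le_mul₀ (by positivity), div_mul_eq_mul_div, one_le_div (by positivity)]
  have h3 : exp (s / 2) * exp (-(s / 2)) = 1 := by rw [← exp_add, add_neg_cancel, exp_zero]
  calc 1 + a = exp (s / 2) * (exp (-(s / 2)) * (1 + a)) := by rw [← mul_assoc, h3, one_mul]
    _ ≤ exp (s / 2) * (1 + exp (-(s / 2)) * a) := mul_le_mul_of_nonneg_left h1 (exp_pos _).le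
    _ = exp (s / 2) * ((1 + exp (-(s / 2)) * a) * 1) := by rw [mul_one]
    _ ≤ exp (s / 2) * ((1 + exp (-(s / 2)) * a) * (1 + exp (-(s / 2)) * a)) :=
        mul_le_mul_of_nonneg_left (mul_le_mul_of_nonneg_left h2 hw.le) (exp_pos _).le
    _ = exp (s / 2) * (1 + exp (-(s / 2)) * a) ^ 2 := by ring

/-- The slice weight is the transport kernel: `e^{-s/2} / (1 + e^{-s/2} a)² = e^{s/2} / (e^{s/2} + a)²`. -/
theorem exp_neg_half_div_weight_sq (a s : ℝ) :
    exp (-(s / 2)) / (1 + exp (-(s / 2)) * a) ^ 2 = exp (s / 2) / (exp (s / 2) + a) ^ 2 := by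
  have h := transport_weight_identity 1 a s
  rw [one_mul] at h
  rw [← h, div_eq_mul_inv, one_div]

/-- `e^{-s/2}` is integrable on `(0, ∞)` with integral `2`. -/
theorem integral_exp_neg_half_Ioi :
    IntegrableOn (fun s : ℝ => exp (-(s / 2))) (Ioi 0) ∧ ∫ s in Ioi (0:ℝ), exp (-(s / 2)) = 2 := by
  have hfun : (fun s : ℝ => exp (-(s / 2))) = fun s => exp ((-(1/2:ℝ)) * s) := by
    funext s; congr 1; ring
  rw [hfun]
  refine ⟨integrableOn_exp_mul_Ioi (by norm_num) 0, ?_⟩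
  rw [integral_exp_mul_Ioi (by norm_num) 0]
  norm_num

/-- `s^{-1/2} e^{-b s}` is integrable on `(0, ∞)` for `b > 0` (Euler's integral for `Γ(1/2)`). -/
theorem integrableOn_rpow_neg_half_mul_exp_neg {b : ℝ} (hb : 0 < b) :
    IntegrableOn (fun s : ℝ => s ^ (-(1 / 2 : ℝ)) * exp (-(b * s))) (Ioi 0) := by
  have h := integrableOn_rpow_mul_exp_neg_mul_rpow (s := -(1 / 2 : ℝ)) (p := 1) (b := b) (by norm_num) le_rfl hb
  refine h.congr_fun (fun _ _ => ?_) measurableSet_Ioi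
  simp only [rpow_one, neg_mul]

/-! ## Domination of the slices, uniformly in the point -/

section Bounds

variable {F : EuclideanSpace ℝ (Fin 3) → EuclideanSpace ℝ (Fin 3)} {C₀ C₁ : ℝ}

/-- `‖DW_s(y)‖ ≤ C₁ e^{-s}` for `F ∈ C¹` with `‖F‖ ≤ C₀`, `‖DF‖ ≤ C₁`. -/
theorem norm_fderiv_freeSlice_le_exp (hF : ContDiff ℝ 1 F) (h0 : ∀ z, ‖F z‖ ≤ C₀) (h1 : ∀ z, ‖fderiv ℝ F z‖ ≤ C₁)
    (α : ℝ) {s : ℝ} (hs : 0 < s) (y : EuclideanSpace ℝ (Fin 3)) :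
    ‖fderiv ℝ (fun z => (Real.exp (-(s / 2)) • rotZL (-(α * s)))
        (heatExtension F (1 - Real.exp (-s)) ((Real.exp (-(s / 2)) • rotZL (α * s)) z))) y‖ ≤ C₁ * exp (-s) := by
  refine (norm_fderiv_freeSlice_le hF.continuous h0 α hs y).trans ?_
  rw [mul_comm]
  exact mul_le_mul_of_nonneg_right
    (norm_fderiv_heatExtension_le_of_C1 hF h0 h1 (heatTime_mem_Ioc hs).1 _) (exp_pos _).le

/-- `‖D²W_s(y)‖ ≤ 2^{3/2} C₁ · s^{-1/2} e^{-s}` for `F ∈ C¹` with `‖F‖ ≤ C₀`, `‖DF‖ ≤ C₁`. -/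
theorem norm_fderiv_fderiv_freeSlice_le_rpow (hF : ContDiff ℝ 1 F) (h0 : ∀ z, ‖F z‖ ≤ C₀)
    (h1 : ∀ z, ‖fderiv ℝ F z‖ ≤ C₁) (α : ℝ) {s : ℝ} (hs : 0 < s) (y : EuclideanSpace ℝ (Fin 3)) :
    ‖fderiv ℝ (fun z => fderiv ℝ (fun z => (Real.exp (-(s / 2)) • rotZL (-(α * s)))
        (heatExtension F (1 - Real.exp (-s)) ((Real.exp (-(s / 2)) • rotZL (α * s)) z))) z) y‖ ≤
      (2 : ℝ) ^ ((3 : ℝ) / 2) * C₁ * (s ^ (-(1 / 2 : ℝ)) * exp (-s)) := by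
  have hC₁ : 0 ≤ C₁ := (norm_nonneg _).trans (h1 0)
  have hτ := (heatTime_mem_Ioc hs).1
  refine (norm_fderiv_fderiv_freeSlice_le hF.continuous h0 α hs y).trans ?_
  have h2 := norm_fderiv_fderiv_heatExtension_le_of_C1 hF h0 h1 hτ ((Real.exp (-(s / 2)) • rotZL (α * s)) y)
  have h3 := heatTime_rpow_neg_half_le hs
  calc exp (-(s / 2)) * exp (-s) *
        ‖fderiv ℝ (fderiv ℝ (heatExtension F (1 - exp (-s)))) ((exp (-(s / 2)) • rotZL (α * s)) y)‖
      ≤ exp (-(s / 2)) * exp (-s) * ((2 : ℝ) ^ ((3 : ℝ) / 2) * (1 - exp (-s)) ^ (-(1 / 2 : ℝ)) * C₁) :=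
        mul_le_mul_of_nonneg_left h2 (by positivity)
    _ ≤ exp (-(s / 2)) * exp (-s) * ((2 : ℝ) ^ ((3 : ℝ) / 2) * (s ^ (-(1 / 2 : ℝ)) * exp (s / 2)) * C₁) := by
        gcongr
    _ = (2 : ℝ) ^ ((3 : ℝ) / 2) * C₁ * (s ^ (-(1 / 2 : ℝ)) * (exp (-(s / 2)) * exp (s / 2) * exp (-s))) := by
        ring
    _ = (2 : ℝ) ^ ((3 : ℝ) / 2) * C₁ * (s ^ (-(1 / 2 : ℝ)) * exp (-s)) := by
        rw [← exp_add, neg_add_cancel, exp_zero, one_mul]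

/-! ## Weighted bounds of the slices -/

/-- **Weighted size of the slice**: with `(1+|z|)² ‖F z‖ ≤ A` and the constant `C_G` of
`sq_weight_heatExtension_le`, `‖W_s(y)‖ ≤ 2 C_G A · e^{s/2} / (e^{s/2} + |y|)²` (the transport kernel). -/
theorem norm_freeSlice_le_kernel {C_G : ℝ} (hCG : 0 ≤ C_G)
    (hG : ∀ ⦃t : ℝ⦄, 0 < t → ∀ {f : EuclideanSpace ℝ (Fin 3) → EuclideanSpace ℝ (Fin 3)}, Continuous f → ∀ {A : ℝ},
      (∀ y, (1 + ‖y‖) ^ 2 * ‖f y‖ ≤ A) → ∀ x : EuclideanSpace ℝ (Fin 3),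
        (1 + ‖x‖) ^ 2 * ‖heatExtension f t x‖ ≤ C_G * (1 + t ^ (3 / 2 : ℝ)) * A)
    (hF : Continuous F) {A : ℝ} (hA : ∀ z, (1 + ‖z‖) ^ 2 * ‖F z‖ ≤ A) (α : ℝ) {s : ℝ} (hs : 0 < s)
    (y : EuclideanSpace ℝ (Fin 3)) :
    ‖(Real.exp (-(s / 2)) • rotZL (-(α * s)))
        (heatExtension F (1 - Real.exp (-s)) ((Real.exp (-(s / 2)) • rotZL (α * s)) y))‖ ≤
      2 * C_G * A * (exp (s / 2) / (exp (s / 2) + ‖y‖) ^ 2) := by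
  obtain ⟨hτ, hτ1⟩ := heatTime_mem_Ioc hs
  have hA0 : 0 ≤ A := le_trans (by positivity) (hA 0)
  set x := (Real.exp (-(s / 2)) • rotZL (α * s)) y with hx
  have hxn : ‖x‖ = exp (-(s / 2)) * ‖y‖ := by
    rw [hx, norm_smul_rotZL_apply, abs_of_pos (exp_pos _)]
  have hg := hG hτ hF hA x
  have h32 : (1 - exp (-s)) ^ (3 / 2 : ℝ) ≤ 1 := rpow_le_one hτ.le hτ1 (by norm_num)
  have hgx : ‖heatExtension F (1 - exp (-s)) x‖ ≤ 2 * C_G * A / (1 + ‖x‖) ^ 2 := by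
    rw [le_div_iff₀ (by positivity), mul_comm]
    refine hg.trans ?_
    have : C_G * (1 + (1 - exp (-s)) ^ (3 / 2 : ℝ)) ≤ 2 * C_G := by nlinarith
    nlinarith
  rw [norm_smul_rotZL_apply, abs_of_pos (exp_pos _)]
  calc exp (-(s / 2)) * ‖heatExtension F (1 - exp (-s)) x‖
      ≤ exp (-(s / 2)) * (2 * C_G * A / (1 + ‖x‖) ^ 2) := mul_le_mul_of_nonneg_left hgx (exp_pos _).le
    _ = 2 * C_G * A * (exp (-(s / 2)) / (1 + exp (-(s / 2)) * ‖y‖) ^ 2) := by rw [hxn]; ring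
    _ = 2 * C_G * A * (exp (s / 2) / (exp (s / 2) + ‖y‖) ^ 2) := by rw [exp_neg_half_div_weight_sq]

/-- **Weighted size of the first space derivative**: with `F ∈ C¹`, `‖F‖ ≤ C₀`, `(1+|z|)² ‖DF z‖ ≤ A'`:
`‖DW_s(y)‖ ≤ 2 C_G A' · e^{-s/2} / (1 + |y|)`. -/
theorem norm_fderiv_freeSlice_le_weight {C_G : ℝ} (hCG : 0 ≤ C_G)
    (hG : ∀ ⦃t : ℝ⦄, 0 < t → ∀ {f : EuclideanSpace ℝ (Fin 3) → EuclideanSpace ℝ (Fin 3) →L[ℝ] EuclideanSpace ℝ (Fin 3)},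
      Continuous f → ∀ {A : ℝ}, (∀ y, (1 + ‖y‖) ^ 2 * ‖f y‖ ≤ A) → ∀ x : EuclideanSpace ℝ (Fin 3),
        (1 + ‖x‖) ^ 2 * ‖heatExtension f t x‖ ≤ C_G * (1 + t ^ (3 / 2 : ℝ)) * A)
    (hF : ContDiff ℝ 1 F) (h0 : ∀ z, ‖F z‖ ≤ C₀) {A' : ℝ} (hA' : ∀ z, (1 + ‖z‖) ^ 2 * ‖fderiv ℝ F z‖ ≤ A')
    (α : ℝ) {s : ℝ} (hs : 0 < s) (y : EuclideanSpace ℝ (Fin 3)) :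
    ‖fderiv ℝ (fun z => (Real.exp (-(s / 2)) • rotZL (-(α * s)))
        (heatExtension F (1 - Real.exp (-s)) ((Real.exp (-(s / 2)) • rotZL (α * s)) z))) y‖ ≤
      2 * C_G * A' * (exp (-(s / 2)) / (1 + ‖y‖)) := by
  obtain ⟨hτ, hτ1⟩ := heatTime_mem_Ioc hs
  have hA1 : ∀ z, ‖fderiv ℝ F z‖ ≤ A' := fun z => by
    have h1 : 1 ≤ (1 + ‖z‖) ^ 2 := one_le_pow₀ (by linarith [norm_nonneg z])
    have := hA' z
    nlinarith [norm_nonneg (fderiv ℝ F z)]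
  have hA0 : 0 ≤ A' := (norm_nonneg _).trans (hA1 0)
  set x := (Real.exp (-(s / 2)) • rotZL (α * s)) y with hx
  have hxn : ‖x‖ = exp (-(s / 2)) * ‖y‖ := by
    rw [hx, norm_smul_rotZL_apply, abs_of_pos (exp_pos _)]
  -- the derivative falls on the data
  have hfun : fderiv ℝ (heatExtension F (1 - exp (-s))) x = heatExtension (fderiv ℝ F) (1 - exp (-s)) x :=
    fderiv_heatExtension_of_bounded hF h0 hA1 hτ x
  have hcont : Continuous (fderiv ℝ F) := hF.continuous_fderiv one_ne_zero
  have hg := hG hτ hcont hA' x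
  have h32 : (1 - exp (-s)) ^ (3 / 2 : ℝ) ≤ 1 := rpow_le_one hτ.le hτ1 (by norm_num)
  have hgx : ‖heatExtension (fderiv ℝ F) (1 - exp (-s)) x‖ ≤ 2 * C_G * A' / (1 + ‖x‖) ^ 2 := by
    rw [le_div_iff₀ (by positivity), mul_comm]
    refine hg.trans ?_
    have : C_G * (1 + (1 - exp (-s)) ^ (3 / 2 : ℝ)) ≤ 2 * C_G := by nlinarith
    nlinarith
  have hder := norm_fderiv_freeSlice_le hF.continuous h0 α hs y
  rw [hfun] at hder
  refine hder.trans ?_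
  have hw : ((1 + exp (-(s / 2)) * ‖y‖) ^ 2)⁻¹ ≤ exp (s / 2) / (1 + ‖y‖) := inv_weight_sq_le hs.le (norm_nonneg y)
  calc exp (-s) * ‖heatExtension (fderiv ℝ F) (1 - exp (-s)) x‖
      ≤ exp (-s) * (2 * C_G * A' / (1 + ‖x‖) ^ 2) := mul_le_mul_of_nonneg_left hgx (exp_pos _).le
    _ = exp (-s) * (2 * C_G * A') * ((1 + exp (-(s / 2)) * ‖y‖) ^ 2)⁻¹ := by rw [hxn]; ring
    _ ≤ exp (-s) * (2 * C_G * A') * (exp (s / 2) / (1 + ‖y‖)) :=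
        mul_le_mul_of_nonneg_left hw (by positivity)
    _ = 2 * C_G * A' * ((exp (-s) * exp (s / 2)) / (1 + ‖y‖)) := by ring
    _ = 2 * C_G * A' * (exp (-(s / 2)) / (1 + ‖y‖)) := by
        rw [← exp_add]; congr 3; ring

/-- `(2τ)^{3/2} ≤ 4` for `0 ≤ τ ≤ 1`. -/
theorem two_mul_rpow_three_halves_le {τ : ℝ} (h0 : 0 ≤ τ) (h1 : τ ≤ 1) : (2 * τ) ^ (3 / 2 : ℝ) ≤ 4 := by
  calc (2 * τ) ^ (3 / 2 : ℝ) ≤ (2 : ℝ) ^ (3 / 2 : ℝ) := rpow_le_rpow (by positivity) (by linarith) (by norm_num)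
    _ ≤ (2 : ℝ) ^ (2 : ℝ) := rpow_le_rpow_of_exponent_le (by norm_num) (by norm_num)
    _ = 4 := by norm_num

/-- **Weighted size of the second space derivative**: with `F ∈ C¹`, `‖F‖ ≤ C₀`, `(1+|z|)² ‖DF z‖ ≤ A'` and the
gradient estimate of `sq_weight_fderiv_heatExtension_le` (constant `C_G ≥ 0`):
`‖D²W_s(y)‖ ≤ 5 · 2^{3/2} C_G A' · s^{-1/2} e^{-s/2} / (1 + |y|)`. -/
theorem norm_fderiv_fderiv_freeSlice_le_weight {C_G : ℝ} (hCG : 0 ≤ C_G)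
    (hG' : ∀ ⦃t : ℝ⦄, 0 < t → ∀ {f : EuclideanSpace ℝ (Fin 3) → EuclideanSpace ℝ (Fin 3) →L[ℝ] EuclideanSpace ℝ (Fin 3)},
      Continuous f → ∀ {A : ℝ}, (∀ y, (1 + ‖y‖) ^ 2 * ‖f y‖ ≤ A) → ∀ x : EuclideanSpace ℝ (Fin 3),
        (1 + ‖x‖) ^ 2 * ‖fderiv ℝ (heatExtension f t) x‖ ≤
          (2 : ℝ) ^ ((3 : ℝ) / 2) * t ^ (-(1 / 2 : ℝ)) * (C_G * (1 + (2 * t) ^ (3 / 2 : ℝ)) * A))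
    (hF : ContDiff ℝ 1 F) (h0 : ∀ z, ‖F z‖ ≤ C₀) {A' : ℝ} (hA' : ∀ z, (1 + ‖z‖) ^ 2 * ‖fderiv ℝ F z‖ ≤ A')
    (α : ℝ) {s : ℝ} (hs : 0 < s) (y : EuclideanSpace ℝ (Fin 3)) :
    ‖fderiv ℝ (fun z => fderiv ℝ (fun z => (Real.exp (-(s / 2)) • rotZL (-(α * s)))
        (heatExtension F (1 - Real.exp (-s)) ((Real.exp (-(s / 2)) • rotZL (α * s)) z))) z) y‖ ≤
      5 * (2 : ℝ) ^ ((3 : ℝ) / 2) * C_G * A' * (s ^ (-(1 / 2 : ℝ)) * exp (-(s / 2)) / (1 + ‖y‖)) := by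
  obtain ⟨hτ, hτ1⟩ := heatTime_mem_Ioc hs
  have hA1 : ∀ z, ‖fderiv ℝ F z‖ ≤ A' := fun z => by
    have h1 : 1 ≤ (1 + ‖z‖) ^ 2 := one_le_pow₀ (by linarith [norm_nonneg z])
    have := hA' z
    nlinarith [norm_nonneg (fderiv ℝ F z)]
  have hA0 : 0 ≤ A' := (norm_nonneg _).trans (hA1 0)
  set x := (Real.exp (-(s / 2)) • rotZL (α * s)) y with hx
  have hxn : ‖x‖ = exp (-(s / 2)) * ‖y‖ := by
    rw [hx, norm_smul_rotZL_apply, abs_of_pos (exp_pos _)]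
  -- one derivative falls on the data
  have hfun : fderiv ℝ (heatExtension F (1 - exp (-s))) = heatExtension (fderiv ℝ F) (1 - exp (-s)) :=
    funext fun z => fderiv_heatExtension_of_bounded hF h0 hA1 hτ z
  have hcont : Continuous (fderiv ℝ F) := hF.continuous_fderiv one_ne_zero
  have hg := hG' hτ hcont hA' x
  have h4 : (2 * (1 - exp (-s))) ^ (3 / 2 : ℝ) ≤ 4 := two_mul_rpow_three_halves_le hτ.le hτ1
  set K : ℝ := 5 * (2 : ℝ) ^ ((3 : ℝ) / 2) * C_G * A' with hK
  have hK0 : 0 ≤ K := by positivity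
  have hgx : ‖fderiv ℝ (heatExtension (fderiv ℝ F) (1 - exp (-s))) x‖ ≤
      K * (1 - exp (-s)) ^ (-(1 / 2 : ℝ)) / (1 + ‖x‖) ^ 2 := by
    rw [le_div_iff₀ (by positivity), mul_comm]
    refine hg.trans ?_
    have h5 : C_G * (1 + (2 * (1 - exp (-s))) ^ (3 / 2 : ℝ)) * A' ≤ 5 * C_G * A' := by
      have : C_G * (1 + (2 * (1 - exp (-s))) ^ (3 / 2 : ℝ)) ≤ 5 * C_G := by nlinarith
      nlinarith
    have hr : 0 ≤ (2 : ℝ) ^ ((3 : ℝ) / 2) * (1 - exp (-s)) ^ (-(1 / 2 : ℝ)) := by positivity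
    calc (2 : ℝ) ^ ((3 : ℝ) / 2) * (1 - exp (-s)) ^ (-(1 / 2 : ℝ)) * (C_G * (1 + (2 * (1 - exp (-s))) ^ (3 / 2 : ℝ)) * A')
        ≤ (2 : ℝ) ^ ((3 : ℝ) / 2) * (1 - exp (-s)) ^ (-(1 / 2 : ℝ)) * (5 * C_G * A') :=
          mul_le_mul_of_nonneg_left h5 hr
      _ = K * (1 - exp (-s)) ^ (-(1 / 2 : ℝ)) := by rw [hK]; ring
  have hder := norm_fderiv_fderiv_freeSlice_le hF.continuous h0 α hs y
  rw [hfun] at hder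
  refine hder.trans ?_
  have hw : ((1 + exp (-(s / 2)) * ‖y‖) ^ 2)⁻¹ ≤ exp (s / 2) / (1 + ‖y‖) := inv_weight_sq_le hs.le (norm_nonneg y)
  have h3 := heatTime_rpow_neg_half_le hs
  calc exp (-(s / 2)) * exp (-s) * ‖fderiv ℝ (heatExtension (fderiv ℝ F) (1 - exp (-s))) x‖
      ≤ exp (-(s / 2)) * exp (-s) * (K * (1 - exp (-s)) ^ (-(1 / 2 : ℝ)) / (1 + ‖x‖) ^ 2) :=
        mul_le_mul_of_nonneg_left hgx (by positivity)
    _ = exp (-(s / 2)) * exp (-s) * K * (1 - exp (-s)) ^ (-(1 / 2 : ℝ)) *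
          ((1 + exp (-(s / 2)) * ‖y‖) ^ 2)⁻¹ := by rw [hxn]; ring
    _ ≤ exp (-(s / 2)) * exp (-s) * K * (s ^ (-(1 / 2 : ℝ)) * exp (s / 2)) * (exp (s / 2) / (1 + ‖y‖)) := by
        gcongr
    _ = K * (s ^ (-(1 / 2 : ℝ)) * (exp (-(s / 2)) * exp (-s) * exp (s / 2) * exp (s / 2)) / (1 + ‖y‖)) := by
        ring
    _ = K * (s ^ (-(1 / 2 : ℝ)) * exp (-(s / 2)) / (1 + ‖y‖)) := by
        congr 3
        rw [← exp_add, ← exp_add, ← exp_add]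
        congr 1; ring

end Bounds

/-! ## Continuity in `s` of the slices and their space derivatives -/

section Continuity

variable {F : EuclideanSpace ℝ (Fin 3) → EuclideanSpace ℝ (Fin 3)} {C : ℝ}

/-- `s ↦ e^{-s/2} R_{as}` is continuous (operator-valued). -/
theorem continuous_exp_smul_rotZL (a : ℝ) :
    Continuous fun s : ℝ => (Real.exp (-(s / 2)) • rotZL (a * s) :
      EuclideanSpace ℝ (Fin 3) →L[ℝ] EuclideanSpace ℝ (Fin 3)) :=
  continuous_iff_continuousAt.2 fun s => (hasDerivAt_exp_smul_rotZL a s).continuousAt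

/-- The outer factor `s ↦ e^{-s/2} R_{−αs}` is continuous. -/
theorem continuous_exp_smul_rotZL_neg (α : ℝ) :
    Continuous fun s : ℝ => (Real.exp (-(s / 2)) • rotZL (-(α * s)) :
      EuclideanSpace ℝ (Fin 3) →L[ℝ] EuclideanSpace ℝ (Fin 3)) := by
  have h := continuous_exp_smul_rotZL (-α)
  simp only [neg_mul] at h
  exact h

/-- The inner pair `s ↦ (1 − e^{-s}, e^{-s/2} R_{αs} y)` is continuous and maps `(0, ∞)` into `(0, ∞) × ℝ³`. -/
theorem continuous_heatTime_prod_point (α : ℝ) (y : EuclideanSpace ℝ (Fin 3)) :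
    Continuous fun s : ℝ => ((1 - Real.exp (-s), (Real.exp (-(s / 2)) • rotZL (α * s)) y) :
      ℝ × EuclideanSpace ℝ (Fin 3)) :=
  (by fun_prop : Continuous fun s : ℝ => 1 - Real.exp (-s)).prodMk
    ((continuous_exp_smul_rotZL α).clm_apply continuous_const)

/-- `s ↦ W_s(y)` is continuous on `(0, ∞)`. -/
theorem continuousOn_freeSlice (hF : Continuous F) (hC : ∀ z, ‖F z‖ ≤ C) (α : ℝ) (y : EuclideanSpace ℝ (Fin 3)) :
    ContinuousOn (fun s : ℝ => (Real.exp (-(s / 2)) • rotZL (-(α * s)))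
        (heatExtension F (1 - Real.exp (-s)) ((Real.exp (-(s / 2)) • rotZL (α * s)) y))) (Ioi 0) :=
  fun _ hs => (hasDerivAt_freeSlice hF hC α hs y).continuousAt.continuousWithinAt

/-- The caloric extension of bounded continuous data is jointly smooth on `(0, ∞) × ℝ³` (tree lemma, in the
`IsSmoothSpaceTimeOn` vocabulary). -/
theorem isSmoothSpaceTimeOn_heatExtension (hF : Continuous F) (hC : ∀ z, ‖F z‖ ≤ C) :
    IsSmoothSpaceTimeOn (Ioi 0) (heatExtension F) :=
  contDiffOn_heatExtension_prod (memLp_top_of_continuous_of_bound hF hC) le_top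

/-- `s ↦ D(e^{τ_sΔ}F)(e^{-s/2} R_{αs} y)` is continuous on `(0, ∞)`. -/
theorem continuousOn_fderiv_heatExtension_along (hF : Continuous F) (hC : ∀ z, ‖F z‖ ≤ C) (α : ℝ)
    (y : EuclideanSpace ℝ (Fin 3)) :
    ContinuousOn (fun s : ℝ => fderiv ℝ (heatExtension F (1 - Real.exp (-s)))
        ((Real.exp (-(s / 2)) • rotZL (α * s)) y)) (Ioi 0) := by
  have h := (isSmoothSpaceTimeOn_heatExtension hF hC).continuousOn_fderiv_slice (uniqueDiffOn_Ioi 0)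
  have hmaps : MapsTo (fun s : ℝ => ((1 - Real.exp (-s), (Real.exp (-(s / 2)) • rotZL (α * s)) y) :
      ℝ × EuclideanSpace ℝ (Fin 3))) (Ioi 0) (Ioi (0:ℝ) ×ˢ (univ : Set (EuclideanSpace ℝ (Fin 3)))) :=
    fun s hs => mk_mem_prod (heatTime_mem_Ioc hs).1 (mem_univ _)
  have h2 := h.comp (continuous_heatTime_prod_point α y).continuousOn hmaps
  exact h2

/-- `s ↦ D²(e^{τ_sΔ}F)(e^{-s/2} R_{αs} y)` is continuous on `(0, ∞)`. -/
theorem continuousOn_fderiv_fderiv_heatExtension_along (hF : Continuous F) (hC : ∀ z, ‖F z‖ ≤ C) (α : ℝ)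
    (y : EuclideanSpace ℝ (Fin 3)) :
    ContinuousOn (fun s : ℝ => fderiv ℝ (fderiv ℝ (heatExtension F (1 - Real.exp (-s))))
        ((Real.exp (-(s / 2)) • rotZL (α * s)) y)) (Ioi 0) := by
  have h := ((isSmoothSpaceTimeOn_heatExtension hF hC).isSmoothSpaceTimeOn_fderiv_of_isOpen
    isOpen_Ioi).continuousOn_fderiv_slice (uniqueDiffOn_Ioi 0)
  have hmaps : MapsTo (fun s : ℝ => ((1 - Real.exp (-s), (Real.exp (-(s / 2)) • rotZL (α * s)) y) :
      ℝ × EuclideanSpace ℝ (Fin 3))) (Ioi 0) (Ioi (0:ℝ) ×ˢ (univ : Set (EuclideanSpace ℝ (Fin 3)))) :=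
    fun s hs => mk_mem_prod (heatTime_mem_Ioc hs).1 (mem_univ _)
  have h2 := h.comp (continuous_heatTime_prod_point α y).continuousOn hmaps
  exact h2

/-- `s ↦ DW_s(y)` is continuous on `(0, ∞)`. -/
theorem continuousOn_fderiv_freeSlice (hF : Continuous F) (hC : ∀ z, ‖F z‖ ≤ C) (α : ℝ)
    (y : EuclideanSpace ℝ (Fin 3)) :
    ContinuousOn (fun s : ℝ => fderiv ℝ (fun z => (Real.exp (-(s / 2)) • rotZL (-(α * s)))
        (heatExtension F (1 - Real.exp (-s)) ((Real.exp (-(s / 2)) • rotZL (α * s)) z))) y) (Ioi 0) := by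
  have h : ContinuousOn (fun s : ℝ => (Real.exp (-(s / 2)) • rotZL (-(α * s))).comp
      ((fderiv ℝ (heatExtension F (1 - Real.exp (-s))) ((Real.exp (-(s / 2)) • rotZL (α * s)) y)).comp
        (Real.exp (-(s / 2)) • rotZL (α * s)))) (Ioi 0) :=
    (continuous_exp_smul_rotZL_neg α).continuousOn.clm_comp
      ((continuousOn_fderiv_heatExtension_along hF hC α y).clm_comp (continuous_exp_smul_rotZL α).continuousOn)
  refine h.congr fun s hs => ?_
  exact (hasFDerivAt_freeSlice_space hF hC α hs y).fderiv

/-- `s ↦ D²W_s(y)` is continuous on `(0, ∞)`. -/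
theorem continuousOn_fderiv_fderiv_freeSlice (hF : Continuous F) (hC : ∀ z, ‖F z‖ ≤ C) (α : ℝ)
    (y : EuclideanSpace ℝ (Fin 3)) :
    ContinuousOn (fun s : ℝ => fderiv ℝ (fun z => fderiv ℝ (fun z => (Real.exp (-(s / 2)) • rotZL (-(α * s)))
        (heatExtension F (1 - Real.exp (-s)) ((Real.exp (-(s / 2)) • rotZL (α * s)) z))) z) y) (Ioi 0) := by
  have hΦ : Continuous fun s : ℝ =>
      ((ContinuousLinearMap.compL ℝ (EuclideanSpace ℝ (Fin 3)) (EuclideanSpace ℝ (Fin 3)) (EuclideanSpace ℝ (Fin 3))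
          (Real.exp (-(s / 2)) • rotZL (-(α * s)))).comp
        ((ContinuousLinearMap.compL ℝ (EuclideanSpace ℝ (Fin 3)) (EuclideanSpace ℝ (Fin 3))
          (EuclideanSpace ℝ (Fin 3))).flip (Real.exp (-(s / 2)) • rotZL (α * s)))) :=
    ((ContinuousLinearMap.compL ℝ (EuclideanSpace ℝ (Fin 3)) (EuclideanSpace ℝ (Fin 3))
      (EuclideanSpace ℝ (Fin 3))).continuous.comp (continuous_exp_smul_rotZL_neg α)).clm_comp
      ((ContinuousLinearMap.compL ℝ (EuclideanSpace ℝ (Fin 3)) (EuclideanSpace ℝ (Fin 3))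
        (EuclideanSpace ℝ (Fin 3))).flip.continuous.comp (continuous_exp_smul_rotZL α))
  have h := hΦ.continuousOn.clm_comp
    ((continuousOn_fderiv_fderiv_heatExtension_along hF hC α y).clm_comp (continuous_exp_smul_rotZL α).continuousOn)
  refine h.congr fun s hs => ?_
  exact (hasFDerivAt_fderiv_freeSlice hF hC α hs y).fderiv

end Continuity

end Summit.NavierStokesRegularity.NavierStokesRegularity.Theorems.KelvinGate

end
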